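import Summits.QuantumFields.YangMills.Theses.LangevinControlUV
import Summits.QuantumFields.YangMills.Theorems.FemtoCurvatureTwoPoint.Negative.PlaquetteFreezing

/-!
# `FemtoCurvatureTwoPoint` — the lower bound forces the asymptotic-freedom dividend
# (`Γ(n·a(β)) → 0`); constant / floored shape functions are impossible for every `G, ρ`

Negative lemma for crux `Summit.QuantumFields.YangMills.Theses.LangevinControlUV.
FemtoCurvatureTwoPoint` (item stmt-QuantumFields-9363; cdisprove gen 1, importable extract of
`§ Consequences` of the crux workfile
`Summits/QuantumFields/YangMills/Cruxes/FemtoCurvatureTwoPoint/Disproof.lean`).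

The crux asks, for each compact simple `G` and faithful `r`, for a unit map `a > 0`, `a → 0`, a
shape `Γ` with `0 < Γ ≤ 1` on `(0, ℓ₀]` and constants such that on every femto torus
(`L · a(β) ≤ ℓ₀`, `β ≥ β₀`) in particular the LOWER bound
`c · Γ(n a(β)) ≤ n⁸ · Cov_{L,β}(P_0^{01}, P_{ne₂}^{01})` holds for `1 ≤ n ≤ L/8`.

* `eventually_femto` — `a → 0` makes EVERY torus femto at all large `β`;
* `tendsto_shape_of_lowerBound` — on a fixed torus the axis covariance tends to `0` as `β → ∞`
  (freezing, `Negative.PlaquetteFreezing.tendsto_plaquetteCov`); hence ANY data satisfying the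
  lower-bound clause alone have `Γ(n · a(β)) → 0` as `β → ∞` for every `n ≥ 1`: the "asymptotic-freedom dividend", which the
  route deliberately left to a later layer, is FORCED by the crux as typed;
* `no_shape_floor`, `no_constant_shape` — refuted strengthenings: no witness can have `Γ`
  bounded below on `(0, ℓ₀]`, in particular the scale-free form `Γ ≡ γ` (two-sided bounds
  `c ≤ n⁸ Cov ≤ C` of free-field shape) is false for EVERY compact `G` and continuous unitary `ρ`;
* `tendsto_shape_nhdsWithin_zero_of_monotone` — under the repair `MonotoneOn Γ (Ioc 0 ℓ₀)`
  proposed on the item (card generic-step-gamma-encoding, retriage-g2) the dividend is genuine: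
  `Γ(s) → 0` as `s → 0⁺`.

To apply these to a crux witness `⟨a, Γ, β₀, ℓ₀, c, C, hℓ, hc, ha, hat, hΓ, hcl⟩ :=
h G hG r` take `hlow := fun L _ β hβ hL n hn hnL => ((hcl L β hβ hL).1 n hn hnL).1`.
-/

noncomputable section

open Filter Topology MeasureTheory
open Literature.MathematicalPhysics.QuantumFieldTheory Literature.MathematicalPhysics.QuantumLattice
open Summit.QuantumFields.YangMills.Theorems.FemtoCurvatureTwoPoint.Negative.PlaquetteFreezing
  (tendsto_plaquetteCov)

namespace Summit.QuantumFields.YangMills.Theorems.FemtoCurvatureTwoPoint.Negative.ForcedDividend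

variable {G : Type} [Group G] [TopologicalSpace G] [IsTopologicalGroup G] [CompactSpace G]
  [MeasurableSpace G] [BorelSpace G] {N : ℕ} (ρ : G →* Matrix (Fin N) (Fin N) ℂ)

omit [Group G] [TopologicalSpace G] [IsTopologicalGroup G] [CompactSpace G] [MeasurableSpace G]
  [BorelSpace G] in
/-- **Every torus is eventually femto**: if `a > 0` and `a → 0` then for every `L`, at all large
`β`, `β₀ ≤ β` and `L · a(β) ≤ ℓ₀` (`ℓ₀ > 0`). -/
theorem eventually_femto {a : ℝ → ℝ} {ℓ₀ : ℝ} (hℓ : 0 < ℓ₀) (ha : ∀ β, 0 < a β)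
    (hat : Tendsto a atTop (𝓝 0)) (β₀ : ℝ) (L : ℕ) :
    ∀ᶠ β in atTop, β₀ ≤ β ∧ (L : ℝ) * a β ≤ ℓ₀ := by
  have h2 : ∀ᶠ β in atTop, a β < ℓ₀ / ((L : ℝ) + 1) :=
    hat (Iio_mem_nhds (div_pos hℓ (by positivity)))
  filter_upwards [eventually_ge_atTop β₀, h2] with β hβ hβ'
  refine ⟨hβ, ?_⟩
  have h3 : a β * ((L : ℝ) + 1) < ℓ₀ := (lt_div_iff₀ (by positivity)).1 hβ'
  nlinarith [ha β]

/-- **The lower bound forces the asymptotic-freedom dividend.** For every compact `G`, continuous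
unitary `ρ` and ANY data `(a, Γ, β₀, ℓ₀, c)` with `ℓ₀, c > 0`, `a > 0`, `a → 0`, `Γ > 0` on
`(0, ℓ₀]` satisfying the crux's lower-bound clause on femto tori, `Γ(n · a(β)) → 0` as `β → ∞`
for every `n ≥ 1` (the torus `L = 8n` is eventually femto and its axis covariance freezes). -/
theorem tendsto_shape_of_lowerBound [SecondCountableTopology G] (hρ : Continuous ρ)
    (hρu : ∀ g, ρ g ∈ Matrix.unitaryGroup (Fin N) ℂ) {a Γ : ℝ → ℝ} {β₀ ℓ₀ c : ℝ} (hℓ : 0 < ℓ₀)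
    (hc : 0 < c) (ha : ∀ β, 0 < a β) (hat : Tendsto a atTop (𝓝 0))
    (hΓ : ∀ s : ℝ, 0 < s → s ≤ ℓ₀ → 0 < Γ s)
    (hlow : ∀ (L : ℕ) [NeZero L] (β : ℝ), β₀ ≤ β → (L : ℝ) * a β ≤ ℓ₀ →
      ∀ n : ℕ, 1 ≤ n → 8 * n ≤ L →
        c * Γ ((n : ℝ) * a β) ≤ (n : ℝ) ^ 8 *
          (wilsonExpectation (d := 4) (L := L) ρ β (fun U =>
              ((N : ℝ) - (ρ (plaquetteHolonomy U (0 : Site 4 L) 0 1)).trace.re) *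
                ((N : ℝ) - (ρ (plaquetteHolonomy U (Pi.single (2 : Fin 4) ((n : ℕ) : ZMod L))
                  0 1)).trace.re)) -
            wilsonExpectation (d := 4) (L := L) ρ β
                (fun U => (N : ℝ) - (ρ (plaquetteHolonomy U (0 : Site 4 L) 0 1)).trace.re) *
              wilsonExpectation (d := 4) (L := L) ρ β (fun U => (N : ℝ) -
                (ρ (plaquetteHolonomy U (Pi.single (2 : Fin 4) ((n : ℕ) : ZMod L)) 0 1)).trace.re)))
    {n : ℕ} (hn : 1 ≤ n) : Tendsto (fun β : ℝ => Γ ((n : ℝ) * a β)) atTop (𝓝 0) := by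
  haveI : NeZero (8 * n) := ⟨by omega⟩
  have hfem := eventually_femto hℓ ha hat β₀ (8 * n)
  have hup := (tendsto_plaquetteCov ρ hρ hρu (0 : Site 4 (8 * n))
    (Pi.single (2 : Fin 4) ((n : ℕ) : ZMod (8 * n))) 0 1 0 1).const_mul ((n : ℝ) ^ 8 / c)
  rw [mul_zero] at hup
  refine tendsto_of_tendsto_of_tendsto_of_le_of_le' tendsto_const_nhds hup ?_ ?_
  · filter_upwards [hfem] with β hβ
    have hn' : (0 : ℝ) < n := by exact_mod_cast hn
    have hs : (n : ℝ) * a β ≤ ℓ₀ := le_trans (by push_cast; nlinarith [ha β]) hβ.2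
    exact (hΓ _ (mul_pos hn' (ha β)) hs).le
  · filter_upwards [hfem] with β hβ
    have h1 := hlow (8 * n) β hβ.1 hβ.2 n hn le_rfl
    rw [div_mul_eq_mul_div, le_div_iff₀ hc]
    linarith

/-- **No shape floor.** Under the same hypotheses `Γ` cannot be bounded below by a positive
constant on `(0, ℓ₀]` — a refuted strengthening of the crux, for every compact `G` and continuous
unitary `ρ`. -/
theorem no_shape_floor [SecondCountableTopology G] (hρ : Continuous ρ)
    (hρu : ∀ g, ρ g ∈ Matrix.unitaryGroup (Fin N) ℂ) {a Γ : ℝ → ℝ} {β₀ ℓ₀ c : ℝ} (hℓ : 0 < ℓ₀)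
    (hc : 0 < c) (ha : ∀ β, 0 < a β) (hat : Tendsto a atTop (𝓝 0))
    (hΓ : ∀ s : ℝ, 0 < s → s ≤ ℓ₀ → 0 < Γ s)
    (hlow : ∀ (L : ℕ) [NeZero L] (β : ℝ), β₀ ≤ β → (L : ℝ) * a β ≤ ℓ₀ →
      ∀ n : ℕ, 1 ≤ n → 8 * n ≤ L →
        c * Γ ((n : ℝ) * a β) ≤ (n : ℝ) ^ 8 *
          (wilsonExpectation (d := 4) (L := L) ρ β (fun U =>
              ((N : ℝ) - (ρ (plaquetteHolonomy U (0 : Site 4 L) 0 1)).trace.re) *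
                ((N : ℝ) - (ρ (plaquetteHolonomy U (Pi.single (2 : Fin 4) ((n : ℕ) : ZMod L))
                  0 1)).trace.re)) -
            wilsonExpectation (d := 4) (L := L) ρ β
                (fun U => (N : ℝ) - (ρ (plaquetteHolonomy U (0 : Site 4 L) 0 1)).trace.re) *
              wilsonExpectation (d := 4) (L := L) ρ β (fun U => (N : ℝ) -
                (ρ (plaquetteHolonomy U (Pi.single (2 : Fin 4) ((n : ℕ) : ZMod L)) 0 1)).trace.re)))
    {γ₀ : ℝ} (hγ : 0 < γ₀) (hfloor : ∀ s : ℝ, 0 < s → s ≤ ℓ₀ → γ₀ ≤ Γ s) : False := by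
  have h1 : ∀ᶠ β in atTop, Γ (((1 : ℕ) : ℝ) * a β) < γ₀ :=
    (tendsto_shape_of_lowerBound ρ hρ hρu hℓ hc ha hat hΓ hlow le_rfl) (Iio_mem_nhds hγ)
  obtain ⟨β, hβ1, hβ2⟩ := (h1.and (eventually_femto hℓ ha hat β₀ 1)).exists
  simp only [Nat.cast_one, one_mul] at hβ1 hβ2
  have := hfloor _ (ha β) hβ2.2
  linarith

/-- **No constant shape.** In particular the scale-free form of the crux (`Γ ≡ γ`, i.e. two-sided
bounds `c γ ≤ n⁸ Cov ≤ C γ` of free-field shape on all femto tori) is false for every compact `G`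
and continuous unitary `ρ`: already its lower bound with `0 < Γ` on `(0, ℓ₀]` is contradictory. -/
theorem no_constant_shape [SecondCountableTopology G] (hρ : Continuous ρ)
    (hρu : ∀ g, ρ g ∈ Matrix.unitaryGroup (Fin N) ℂ) {a : ℝ → ℝ} {γ β₀ ℓ₀ c : ℝ} (hℓ : 0 < ℓ₀)
    (hc : 0 < c) (ha : ∀ β, 0 < a β) (hat : Tendsto a atTop (𝓝 0))
    (hγ : ∀ s : ℝ, 0 < s → s ≤ ℓ₀ → 0 < γ)
    (hlow : ∀ (L : ℕ) [NeZero L] (β : ℝ), β₀ ≤ β → (L : ℝ) * a β ≤ ℓ₀ →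
      ∀ n : ℕ, 1 ≤ n → 8 * n ≤ L →
        c * γ ≤ (n : ℝ) ^ 8 *
          (wilsonExpectation (d := 4) (L := L) ρ β (fun U =>
              ((N : ℝ) - (ρ (plaquetteHolonomy U (0 : Site 4 L) 0 1)).trace.re) *
                ((N : ℝ) - (ρ (plaquetteHolonomy U (Pi.single (2 : Fin 4) ((n : ℕ) : ZMod L))
                  0 1)).trace.re)) -
            wilsonExpectation (d := 4) (L := L) ρ β
                (fun U => (N : ℝ) - (ρ (plaquetteHolonomy U (0 : Site 4 L) 0 1)).trace.re) *
              wilsonExpectation (d := 4) (L := L) ρ β (fun U => (N : ℝ) -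
                (ρ (plaquetteHolonomy U (Pi.single (2 : Fin 4) ((n : ℕ) : ZMod L)) 0 1)).trace.re))) :
    False :=
  no_shape_floor ρ hρ hρu (Γ := fun _ => γ) hℓ hc ha hat hγ hlow (hγ ℓ₀ hℓ le_rfl)
    fun _ _ _ => le_rfl

/-- **Under the repair `MonotoneOn Γ (Ioc 0 ℓ₀)`** the dividend is genuine asymptotic freedom of the
shape: `Γ(s) → 0` as `s → 0⁺` (recorded for the planner: a repaired crux asserts it outright). -/
theorem tendsto_shape_nhdsWithin_zero_of_monotone [SecondCountableTopology G] (hρ : Continuous ρ)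
    (hρu : ∀ g, ρ g ∈ Matrix.unitaryGroup (Fin N) ℂ) {a Γ : ℝ → ℝ} {β₀ ℓ₀ c : ℝ} (hℓ : 0 < ℓ₀)
    (hc : 0 < c) (ha : ∀ β, 0 < a β) (hat : Tendsto a atTop (𝓝 0))
    (hΓ : ∀ s : ℝ, 0 < s → s ≤ ℓ₀ → 0 < Γ s)
    (hlow : ∀ (L : ℕ) [NeZero L] (β : ℝ), β₀ ≤ β → (L : ℝ) * a β ≤ ℓ₀ →
      ∀ n : ℕ, 1 ≤ n → 8 * n ≤ L →
        c * Γ ((n : ℝ) * a β) ≤ (n : ℝ) ^ 8 *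
          (wilsonExpectation (d := 4) (L := L) ρ β (fun U =>
              ((N : ℝ) - (ρ (plaquetteHolonomy U (0 : Site 4 L) 0 1)).trace.re) *
                ((N : ℝ) - (ρ (plaquetteHolonomy U (Pi.single (2 : Fin 4) ((n : ℕ) : ZMod L))
                  0 1)).trace.re)) -
            wilsonExpectation (d := 4) (L := L) ρ β
                (fun U => (N : ℝ) - (ρ (plaquetteHolonomy U (0 : Site 4 L) 0 1)).trace.re) *
              wilsonExpectation (d := 4) (L := L) ρ β (fun U => (N : ℝ) -
                (ρ (plaquetteHolonomy U (Pi.single (2 : Fin 4) ((n : ℕ) : ZMod L)) 0 1)).trace.re)))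
    (hmono : MonotoneOn Γ (Set.Ioc 0 ℓ₀)) : Tendsto Γ (𝓝[>] 0) (𝓝 0) := by
  rw [Metric.tendsto_nhdsWithin_nhds]
  intro ε hε
  have h1 : ∀ᶠ β in atTop, Γ (((1 : ℕ) : ℝ) * a β) < ε :=
    (tendsto_shape_of_lowerBound ρ hρ hρu hℓ hc ha hat hΓ hlow le_rfl) (Iio_mem_nhds hε)
  obtain ⟨β, hβ1, hβ2⟩ := (h1.and (eventually_femto hℓ ha hat β₀ 1)).exists
  simp only [Nat.cast_one, one_mul] at hβ1 hβ2
  refine ⟨a β, ha β, fun s hs0 hsd => ?_⟩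
  simp only [Set.mem_Ioi] at hs0
  rw [Real.dist_eq, sub_zero] at hsd ⊢
  have hsle : s ≤ a β := by
    have := (abs_lt.1 hsd).2; linarith
  have hΓs := hΓ s hs0 (hsle.trans hβ2.2)
  have hmon : Γ s ≤ Γ (a β) := hmono ⟨hs0, hsle.trans hβ2.2⟩ ⟨ha β, hβ2.2⟩ hsle
  rw [abs_of_pos hΓs]
  linarith

end Summit.QuantumFields.YangMills.Theorems.FemtoCurvatureTwoPoint.Negative.ForcedDividend

end
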